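/-
Copyright (c) 2026 the pub-hodgecm-mathlib formalisation cell (harness21).  Prover seat hodgecm-mathlib-K2E5-p01 (g4) (free E5 hand, cross-unit), HCML Track B «K2-LIT»,
h413 = `stmt-HodgeConjecture-24833`, line `K2_E3_EllipticInputs`, unit U12, socket #11 road (SC-an), road «FC» (finite conjugation measure; (SC-an) line lead K2E3-p14 (g4)
RULINGS #15 ∕ MAP v5 2026-09-04T03:42:59Z), brick (FC-A).  2026-09-04.
-/
import Mathlib.MeasureTheory.Measure.Haar.Basic
import Mathlib.MeasureTheory.Integral.Lebesgue.Markov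
import HarnessLib

/-!
# K2 · E3 · (SC-an) road «FC», brick (FC-A): THE CONJUGATION FIBRE INTEGRAL IS INFINITE AT AN ELEMENT WITH NON-COMPACT CENTRALISER —
# `Z(g)` not compact, `β ≥ 0` continuous with `β(x₀ g x₀⁻¹) ≠ 0` ⟹ `∫⁻ x, β(x g x⁻¹) dμ = ⊤`

Cell `pub/hodgecm-mathlib`, crux H413 = `stmt-HodgeConjecture-24833` (lane `--supports … --as helper`, count-neutral); (SC-an) line lead K2E3-p14 (g4) (road «FC» (R15-1):
«`g ∈ Φ_β` with `β(x₀ g x₀⁻¹) > 0` ⇒ `Z_U(g)` COMPACT (else `∫ β(x g x⁻¹) ≥ c · μ(V x₀ Z(g)) = ∞`, disjoint translates)»), dealer K2E3-plan (g3).  THEOREMS ONLY (no `def` ∕ `instance` ∕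
`notation` ∕ named fact ∕ `sorry`); Mathlib-only imports.  GENERIC FRAME: `G` a locally compact Hausdorff topological group with Borel σ-algebra, `μ` a Haar measure on `G`
which is also right invariant.

THE MATHEMATICS.  `f(x) := β(x g x⁻¹)` is continuous and RIGHT-`Z(g)`-INVARIANT (`f(x z) = f(x)` for `z` centralising `g`), and `f > c > 0` on an open `O ∋ x₀`; so `f > c` on
`O · Z(g)`.  If the closed subgroup `Z(g)` is not compact, no compact set contains it, so one picks inductively `y_n ∈ Z(g)` outside the compact `⋃_{m<n} K⁻¹K · y_m` (`K` a
compact set containing a non-empty open `W ⊆ O`); then the right translates `W · y_n` are pairwise disjoint, each of Haar measure `μ(W) > 0` (right invariance), whence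
`μ(O · Z(g)) = ⊤` and, by Markov, `∫⁻ f ≥ c · μ{f ≥ c} = ⊤`.
* §1 `measure_mul_eq_top_of_isClosed_not_isCompact` — `W` open non-empty, `Z` closed non-compact ⟹ `μ(W · Z) = ⊤` (the disjoint-translates argument).
* §2 **`lintegral_conj_eq_top_of_not_isCompact_centralizer`** — the (FC-A) head, letters of RULINGS #15.

HONEST LABEL: HC_CM is proved only modulo the 7 printed citations (2 remaining named inputs: hLiu418 = `stmt-HodgeConjecture-24832`, h413 = `stmt-HodgeConjecture-24833`)
until rung 0 closes; count-neutral helper (generic measure theory; brick (FC-A) of road «FC»; (SC-an) is NOT ★).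

## References
* [HarishChandra1970] Harish-Chandra (notes by G. van Dijk), *Harmonic Analysis on Reductive p-adic Groups*, LNM 162 (1970), Part V §4 Lemma 22 p. 48 (orbital integrals and
  compactness of the centraliser); Part VI §8 p. 60.
* [Folland1995] G. B. Folland, *A Course in Abstract Harmonic Analysis* (1995), §2.2 (Haar measure: positivity on open sets, translation invariance).
-/

set_option autoImplicit false
-- the mandated namespace has the single-problem summit's repeated segment (`HodgeConjecture.HodgeConjecture`)
set_option linter.dupNamespace false

noncomputable section

open MeasureTheory Measure Set Filter Topology
open scoped ENNReal Pointwise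

namespace Summit.HodgeConjecture.HodgeConjecture.Cruxes.H413.K2E3ConjFibreInfinite

variable {G : Type*} [Group G] [TopologicalSpace G] [IsTopologicalGroup G] [LocallyCompactSpace G] [T2Space G]
  [MeasurableSpace G] [BorelSpace G] (μ : Measure G) [μ.IsHaarMeasure] [μ.IsMulRightInvariant]

/-! ## §1 A non-empty open set times a closed non-compact set has infinite Haar measure -/

omit [LocallyCompactSpace G] [T2Space G] [μ.IsHaarMeasure] in
/-- Right translates have the same measure: `μ(W · {y}) = μ(W)` (`W · {y}` is the preimage of `W` under `x ↦ x y⁻¹`). [cite: Folland1995, §2.2] -/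
theorem measure_mul_singleton_eq (W : Set G) (y : G) : μ (W * {y}) = μ W := by
  have hset : W * {y} = (fun x : G => x * y⁻¹) ⁻¹' W := by
    ext x
    simp only [Set.mem_mul, Set.mem_singleton_iff, Set.mem_preimage]
    constructor
    · rintro ⟨w, hw, z, rfl, rfl⟩
      simpa using hw
    · intro hx
      exact ⟨x * y⁻¹, hx, y, rfl, by simp⟩
  rw [hset, measure_preimage_mul_right]

omit [T2Space G] in
/-- **`μ(W · Z) = ⊤` for `W` open non-empty and `Z` closed non-compact** in a locally compact Hausdorff group with a right-invariant Haar measure: infinitely many pairwise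
disjoint right translates `W′ · y_n ⊆ W · Z` (`y_n ∈ Z` chosen outside the compact `⋃_{m<n} K⁻¹K · y_m`), each of measure `μ(W′) > 0`.
[cite: HarishChandra1970, Part V §4 Lemma 22] [cite: Folland1995, §2.2] -/
theorem measure_mul_eq_top_of_isClosed_not_isCompact {W Z : Set G} (hWo : IsOpen W) (hWne : W.Nonempty) (hZc : IsClosed Z) (hZ : ¬ IsCompact Z) :
    μ (W * Z) = ⊤ := by
  classical
  obtain ⟨w₀, hw₀⟩ := hWne
  -- shrink `W` to an open `W′ ∋ w₀` inside a compact `K`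
  obtain ⟨K, hK, hKw₀⟩ := exists_compact_mem_nhds w₀
  set W' : Set G := W ∩ interior K with hW'
  have hW'o : IsOpen W' := hWo.inter isOpen_interior
  have hW'ne : W'.Nonempty := ⟨w₀, hw₀, mem_interior_iff_mem_nhds.2 hKw₀⟩
  have hW'K : W' ⊆ K := fun x hx => interior_subset hx.2
  have hW'W : W' ⊆ W := fun x hx => hx.1
  -- the compact "collision set" `D = K⁻¹ K`
  have hD : IsCompact (K⁻¹ * K) := hK.inv.mul hK
  -- one step of the choice: a point of `Z` off finitely many translates of `D`
  have step : ∀ s : Finset G, ∃ y ∈ Z, y ∉ ⋃ z ∈ s, (K⁻¹ * K) * {z} := by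
    intro s
    by_contra h
    push Not at h
    have hsub : Z ⊆ ⋃ z ∈ s, (K⁻¹ * K) * {z} := fun y hy => h y hy
    exact hZ ((s.isCompact_biUnion fun z _ => hD.mul isCompact_singleton).of_isClosed_subset hZc hsub)
  choose pick hpickZ hpick using step
  -- the sequence `y_n := pick (S_n)`, `S_{n+1} := insert y_n S_n`
  let S : ℕ → Finset G := fun n => Nat.rec ∅ (fun _ s => insert (pick s) s) n
  let y : ℕ → G := fun n => pick (S n)
  have hS_succ : ∀ n, S (n + 1) = insert (y n) (S n) := fun n => rfl
  have hmem : ∀ m n, m < n → y m ∈ S n := by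
    intro m n hmn
    induction n with
    | zero => exact absurd hmn (Nat.not_lt_zero _)
    | succ n ih =>
      rw [hS_succ]
      rcases Nat.lt_succ_iff_lt_or_eq.1 hmn with h | h
      · exact Finset.mem_insert_of_mem (ih h)
      · rw [h]; exact Finset.mem_insert_self _ _
  -- `y_n ∉ D · y_m` for `m < n`
  have hsep : ∀ m n, m < n → y n ∉ (K⁻¹ * K) * {y m} := by
    intro m n hmn hyn
    exact hpick (S n) (Set.mem_iUnion₂.2 ⟨y m, hmem m n hmn, hyn⟩)
  -- the translates `W′ · y_n` are pairwise disjoint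
  have hdisj' : ∀ m n, m < n → Disjoint (W' * {y m}) (W' * {y n}) := by
    intro m n hmn
    rw [Set.disjoint_left]
    rintro x ⟨w, hw, _, rfl, rfl⟩ ⟨w', hw', _, rfl, hx⟩
    -- `w' * y n = w * y m` ⇒ `y n = w'⁻¹ w y m ∈ K⁻¹ K · y m`
    apply hsep m n hmn
    refine ⟨w'⁻¹ * w, Set.mul_mem_mul (Set.inv_mem_inv.2 (hW'K hw')) (hW'K hw), y m, rfl, ?_⟩
    have hx' : w' * y n = w * y m := hx
    calc w'⁻¹ * w * y m = w'⁻¹ * (w * y m) := by group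
      _ = w'⁻¹ * (w' * y n) := by rw [hx']
      _ = y n := by group
  have hdisj : Pairwise (Function.onFun Disjoint fun n => W' * {y n}) := by
    intro m n hmn
    rcases lt_or_gt_of_ne hmn with h | h
    · exact hdisj' m n h
    · exact (hdisj' n m h).symm
  -- their union lies in `W · Z` and has infinite measure
  have hsub : (⋃ n, W' * {y n}) ⊆ W * Z := by
    intro x hx
    obtain ⟨n, hn⟩ := Set.mem_iUnion.1 hx
    obtain ⟨w, hw, _, rfl, rfl⟩ := hn
    exact Set.mul_mem_mul (hW'W hw) (hpickZ (S n))
  have hpos : μ W' ≠ 0 := (hW'o.measure_pos μ hW'ne).ne'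
  have hU : μ (⋃ n, W' * {y n}) = ⊤ := by
    rw [measure_iUnion hdisj fun n => (hW'o.mul_right).measurableSet]
    simp_rw [measure_mul_singleton_eq μ W']
    exact ENNReal.tsum_const_eq_top_of_ne_zero hpos
  exact top_le_iff.1 (hU ▸ measure_mono hsub)

/-! ## §2 The conjugation fibre integral at an element with non-compact centraliser -/

/-- **(FC-A) «THE CONJUGATION FIBRE INTEGRAL IS INFINITE OFF THE COMPACT-CENTRALISER LOCUS».**  `G` a locally compact Hausdorff group, `μ` a left- and right-invariant Haar
measure, `β : G → [0, ∞]` CONTINUOUS; if the centraliser `Z(g)` is NOT compact and `β(x₀ g x₀⁻¹) ≠ 0` for some `x₀`, then `∫⁻ x, β(x g x⁻¹) dμ(x) = ⊤`.  Proof: `f(x) := β(x g x⁻¹)`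
is continuous, right-`Z(g)`-invariant and `> c > 0` on an open `O ∋ x₀`, hence on `O · Z(g)`, a set of infinite measure (§1, `Z(g)` is closed); Markov's inequality.
Road «FC» uses it as «`∫ β(x g x⁻¹) < ∞` with `β(x₀ g x₀⁻¹) > 0` forces `Z_U(g)` compact». [cite: HarishChandra1970, Part V §4 Lemma 22 p. 48; Part VI §8 p. 60] -/
theorem lintegral_conj_eq_top_of_not_isCompact_centralizer {β : G → ℝ≥0∞} (hβ : Continuous β) {g x₀ : G}
    (hZ : ¬ IsCompact ((Subgroup.centralizer ({g} : Set G)) : Set G)) (hx₀ : β (x₀ * g * x₀⁻¹) ≠ 0) :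
    ∫⁻ x, β (x * g * x⁻¹) ∂μ = ⊤ := by
  -- the integrand and its right-`Z(g)`-invariance
  have hf : Continuous fun x : G => β (x * g * x⁻¹) := hβ.comp ((continuous_id.mul continuous_const).mul continuous_id.inv)
  have hinv : ∀ x z : G, z ∈ Subgroup.centralizer ({g} : Set G) → β ((x * z) * g * (x * z)⁻¹) = β (x * g * x⁻¹) := by
    intro x z hz
    have hzg : g * z = z * g := (Subgroup.mem_centralizer_iff.1 hz) g (Set.mem_singleton g)
    have : (x * z) * g * (x * z)⁻¹ = x * g * x⁻¹ := by
      calc (x * z) * g * (x * z)⁻¹ = x * (z * g) * z⁻¹ * x⁻¹ := by group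
        _ = x * (g * z) * z⁻¹ * x⁻¹ := by rw [hzg]
        _ = x * g * x⁻¹ := by group
    rw [this]
  -- a positive level `c < β(x₀ g x₀⁻¹)`
  set c : ℝ≥0∞ := min (β (x₀ * g * x₀⁻¹) / 2) 1 with hc
  have hc0 : c ≠ 0 := (lt_min (ENNReal.half_pos hx₀) one_pos).ne'
  have hcx₀ : c < β (x₀ * g * x₀⁻¹) := by
    rcases eq_or_ne (β (x₀ * g * x₀⁻¹)) ⊤ with htop | htop
    · rw [htop]; exact lt_of_le_of_lt (min_le_right _ _) ENNReal.one_lt_top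
    · exact lt_of_le_of_lt (min_le_left _ _) (ENNReal.half_lt_self hx₀ htop)
  -- the open set `O = {c < f}` and the closed non-compact centraliser
  have hO : IsOpen {x : G | c < β (x * g * x⁻¹)} := isOpen_lt continuous_const hf
  have hZc : IsClosed ((Subgroup.centralizer ({g} : Set G)) : Set G) := by
    have hset : ((Subgroup.centralizer ({g} : Set G)) : Set G) = {z : G | g * z = z * g} := by
      ext z
      simp only [SetLike.mem_coe, Subgroup.mem_centralizer_iff, Set.mem_singleton_iff, forall_eq, Set.mem_setOf_eq]
    rw [hset]
    exact isClosed_eq (continuous_const.mul continuous_id) (continuous_id.mul continuous_const)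
  -- `O · Z(g) ⊆ {c < f} ⊆ {c ≤ f}`
  have hsub : {x : G | c < β (x * g * x⁻¹)} * ((Subgroup.centralizer ({g} : Set G)) : Set G) ⊆ {x : G | c ≤ β (x * g * x⁻¹)} := by
    rintro _ ⟨o, ho, z, hz, rfl⟩
    have ho' : c < β (o * g * o⁻¹) := ho
    rw [Set.mem_setOf_eq, hinv o z hz]
    exact ho'.le
  have htop : μ {x : G | c ≤ β (x * g * x⁻¹)} = ⊤ :=
    top_le_iff.1 ((measure_mul_eq_top_of_isClosed_not_isCompact μ hO ⟨x₀, hcx₀⟩ hZc hZ) ▸ measure_mono hsub)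
  -- Markov
  have hmarkov := mul_meas_ge_le_lintegral₀ (μ := μ) hf.measurable.aemeasurable c
  rw [htop, ENNReal.mul_top hc0] at hmarkov
  exact top_le_iff.1 hmarkov

end Summit.HodgeConjecture.HodgeConjecture.Cruxes.H413.K2E3ConjFibreInfinite

end
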